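import Summits.CriticalPhenomena.CardyFormulaZ2.Theorems.CardyFlipRussoVoronoiHubFromSmirnovGraphDefs
import Summits.CriticalPhenomena.CardyFormulaZ2.Theorems.CardyFlipRussoVoronoiHubFromSmirnovHoloUniformBounds
import Summits.CriticalPhenomena.CardyFormulaZ2.Theorems.CardyFlipRussoVoronoiHubFromSmirnovHNearest

/-!
# Stub `stub_attachmentImage` of line `moebius-exact-delaunay-dilation-ward`
# (crux `VoronoiHubFromSmirnov`, stmt-CriticalPhenomena-6433) — brick of the S3b re-cut

TRANSPORT OF ADMISSIBLE FAMILIES (`Sig.stub_attachmentImage`, GraphDefs module): if `h` is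
holomorphic and injective on an open `U ⊇ closure Ω`, then the `h`-images of admissible
attachment families `A δ` of the arc `R.arc i` (measurable, sandwiched between the `a√δ`- and
`b√δ`-neighbourhoods of the arc, eventually as `δ → 0⁺`) are admissible attachment families of
the arc `h '' R.arc i` of the image rectangle `h • R = R.imageUnivalent h`, and likewise for
admissible carrier families (neighbourhoods of `closure Ω`, whose image is the closure of the
image carrier).

Proof.  Both conjuncts are the case `T = R.arc i`, resp. `T = closure Ω`, of one statement
(`ai_family_image`) about a compact `T ⊆ U`:
* constants: the uniform `C²` package `r₁, L, m, Λ` of `h` on the balls `closedBall x r₁`,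
  `x ∈ T` (landed `holo_uniform_bounds`); a compact collar `cthickening r T ⊆ U` with the
  injectivity modulus `η'` at threshold `R₁ = min r₁ (m / (4 (L + 1)))` (landed
  `hub_uniform_injOn`); the image `h '' thickening r T` of the open collar is open (invariance
  of domain, tree `Brouwer.isOpen_image_of_injOn`), so some `ε`-neighbourhood of the compact
  `h '' T` lies in it;
* upper sandwich `h '' thickening (b√δ) T ⊆ thickening ((Λ + L + 1) b √δ) (h '' T)` once
  `b√δ ≤ min r₁ 1`: the upper secant bound `dist (h z) (h x) ≤ ‖h′ x‖ d + L d²`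
  (landed `dic_secant_two_sided` on the convex ball);
* lower sandwich `thickening ((m/2) a √δ) (h '' T) ⊆ h '' thickening (a√δ) T` once
  `(m/2) a √δ ≤ min ε η'`: a point `w` within `(m/2) a √δ` of `h x`, `x ∈ T`, is `h z` with `z`
  in the collar, the modulus forces `dist z x < R₁ ≤ r₁`, and the lower secant bound
  (`dic_secant_two_sided`, `hn_lower_arith`) gives `(3m/4) dist z x ≤ dist (h z) (h x)`, whence
  `dist z x < a√δ`;
* measurability of `h '' A δ`: `A δ ⊆ thickening (b√δ) T ⊆ U`, `h` continuous and injective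
  there — Lusin–Souslin (`MeasurableSet.image_of_continuousOn_injOn`);
* all smallness conditions hold eventually as `δ → 0⁺` since `√δ → 0`.
Finally `(R.imageUnivalent h).arc i = h '' R.arc i` and
`closure (R.imageUnivalent h).carrier = h '' closure Ω` (tree, `ImageUnivalent`).
All [folklore]; context: I. Benjamini, O. Schramm, *Conformal invariance of Voronoi
percolation*, Comm. Math. Phys. 197 (1998) 75–107, §4 (the map is bi-Lipschitz near `closure Ω`).
-/

noncomputable section

namespace Summit.CriticalPhenomena.CardyFormulaZ2.Cruxes.VoronoiHubFromSmirnov.MoebiusExactDelaunayDilationWard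

open scoped Topology
open Filter Set Metric Literature.Probability.RandomPlanarGeometry

/-! ### Smallness conditions hold eventually as `δ → 0⁺` -/

/-- For `κ > 0` and any real `c`, eventually as `δ → 0⁺` we have `c √δ < κ` (`√δ → 0`).
[folklore] -/
theorem ai_eventually_mul_sqrt_lt (c : ℝ) {κ : ℝ} (hκ : 0 < κ) :
    ∀ᶠ δ : ℝ in 𝓝[>] 0, c * Real.sqrt δ < κ := by
  have h1 : Tendsto (fun δ : ℝ => c * Real.sqrt δ) (𝓝 0) (𝓝 (c * Real.sqrt 0)) :=
    (continuous_const.mul Real.continuous_sqrt).tendsto 0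
  rw [Real.sqrt_zero, mul_zero] at h1
  exact (h1.mono_left nhdsWithin_le_nhds).eventually (eventually_lt_nhds hκ)

/-! ### Pointwise secant estimates on the balls of the uniform `C²` package -/

/-- **Upper distance bound.**  On a ball `closedBall x r₁` carrying the `C²` package
(`h' = deriv h`, `(deriv h)' = deriv (deriv h)`, `‖deriv h‖ ≤ Λ`, `‖deriv (deriv h)‖ ≤ L`), a
point `z` with `dist z x < ℓ ≤ min r₁ 1` satisfies `dist (h z) (h x) < (Λ + L + 1) ℓ` (upper
secant bound `‖h′ x‖ d + L d² ≤ Λ ℓ + L ℓ`). [folklore] -/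
theorem ai_upper_dist {h : ℂ → ℂ} {x z : ℂ} {r₁ L m Λ ℓ : ℝ} (hL : 0 ≤ L) (hΛ : 0 ≤ Λ)
    (hDx : ∀ w ∈ closedBall x r₁, HasDerivAt h (deriv h w) w ∧
      HasDerivAt (deriv h) (deriv (deriv h) w) w ∧ m ≤ ‖deriv h w‖ ∧ ‖deriv h w‖ ≤ Λ ∧
      ‖deriv (deriv h) w‖ ≤ L)
    (hℓr : ℓ ≤ r₁) (hℓ1 : ℓ ≤ 1) (hzx : dist z x < ℓ) :
    dist (h z) (h x) < (Λ + L + 1) * ℓ := by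
  have hd0 : 0 ≤ dist z x := dist_nonneg
  have hℓ : 0 < ℓ := hd0.trans_lt hzx
  have hz : z ∈ closedBall x r₁ := mem_closedBall.2 (hzx.le.trans hℓr)
  have hx : x ∈ closedBall x r₁ := mem_closedBall_self (hℓ.le.trans hℓr)
  have hsec := (dic_secant_two_sided (h₁ := deriv h) (h₂ := deriv (deriv h))
    (convex_closedBall x r₁) hL (fun w hw => (hDx w hw).1) (fun w hw => (hDx w hw).2.1)
    (fun w hw => (hDx w hw).2.2.2.2) hx hz).2
  have hA : ‖deriv h x‖ ≤ Λ := (hDx x hx).2.2.2.1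
  have h1 : ‖deriv h x‖ * dist z x ≤ Λ * ℓ :=
    (mul_le_mul_of_nonneg_right hA hd0).trans (mul_le_mul_of_nonneg_left hzx.le hΛ)
  have h2 : dist z x ^ 2 ≤ ℓ := by
    have h3 : dist z x ^ 2 ≤ ℓ * ℓ := by
      rw [pow_two]; exact mul_le_mul hzx.le hzx.le hd0 hℓ.le
    exact h3.trans (mul_le_of_le_one_left hℓ.le hℓ1)
  have h4 : L * dist z x ^ 2 ≤ L * ℓ := mul_le_mul_of_nonneg_left h2 hL
  calc dist (h z) (h x) ≤ Λ * ℓ + L * ℓ := hsec.trans (add_le_add h1 h4)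
    _ = (Λ + L) * ℓ := by ring
    _ < (Λ + L + 1) * ℓ := mul_lt_mul_of_pos_right (lt_add_one _) hℓ

/-- **Lower distance bound.**  On a ball `closedBall x r₁` carrying the `C²` package
(`m ≤ ‖deriv h‖`, `‖deriv (deriv h)‖ ≤ L`), a point `z` with
`dist z x < R₁ ≤ min r₁ (m / (4 (L + 1)))` satisfies `(3m/4) dist z x ≤ dist (h z) (h x)`
(lower secant bound and `hn_lower_arith`). [folklore] -/
theorem ai_lower_dist {h : ℂ → ℂ} {x z : ℂ} {r₁ L m Λ R₁ : ℝ} (hL : 0 ≤ L)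
    (hDx : ∀ w ∈ closedBall x r₁, HasDerivAt h (deriv h w) w ∧
      HasDerivAt (deriv h) (deriv (deriv h) w) w ∧ m ≤ ‖deriv h w‖ ∧ ‖deriv h w‖ ≤ Λ ∧
      ‖deriv (deriv h) w‖ ≤ L)
    (hR₁r : R₁ ≤ r₁) (hR₁m : R₁ ≤ m / (4 * (L + 1))) (hzx : dist z x < R₁) :
    3 * m / 4 * dist z x ≤ dist (h z) (h x) := by
  have hz : z ∈ closedBall x r₁ := mem_closedBall.2 (hzx.le.trans hR₁r)
  have hx : x ∈ closedBall x r₁ := mem_closedBall_self (dist_nonneg.trans (hzx.le.trans hR₁r))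
  have hsec := (dic_secant_two_sided (h₁ := deriv h) (h₂ := deriv (deriv h))
    (convex_closedBall x r₁) hL (fun w hw => (hDx w hw).1) (fun w hw => (hDx w hw).2.1)
    (fun w hw => (hDx w hw).2.2.2.2) hx hz).1
  exact hn_lower_arith hL (hDx x hx).2.2.1 dist_nonneg hzx hR₁m hsec

/-! ### The two sandwiches and measurability of the image -/

/-- Thin neighbourhoods of `T` lie in `U`: if every `closedBall x r₁`, `x ∈ T`, lies in `U` and
`ℓ ≤ r₁`, then `thickening ℓ T ⊆ U`. [folklore] -/
theorem ai_thickening_subset {U T : Set ℂ} {r₁ ℓ : ℝ}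
    (hballU : ∀ x ∈ T, closedBall x r₁ ⊆ U) (hℓr : ℓ ≤ r₁) : thickening ℓ T ⊆ U := by
  intro z hz
  obtain ⟨x, hxT, hzx⟩ := mem_thickening_iff.1 hz
  exact hballU x hxT (mem_closedBall.2 (hzx.le.trans hℓr))

/-- **Upper sandwich.**  With the `C²` package on the balls `closedBall x r₁`, `x ∈ T`, and
`ℓ ≤ min r₁ 1`: `h '' thickening ℓ T ⊆ thickening ((Λ + L + 1) ℓ) (h '' T)`. [folklore] -/
theorem ai_image_thickening_subset {h : ℂ → ℂ} {T : Set ℂ} {r₁ L m Λ ℓ : ℝ} (hL : 0 ≤ L)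
    (hΛ : 0 ≤ Λ)
    (hD : ∀ x ∈ T, ∀ w ∈ closedBall x r₁, HasDerivAt h (deriv h w) w ∧
      HasDerivAt (deriv h) (deriv (deriv h) w) w ∧ m ≤ ‖deriv h w‖ ∧ ‖deriv h w‖ ≤ Λ ∧
      ‖deriv (deriv h) w‖ ≤ L)
    (hℓr : ℓ ≤ r₁) (hℓ1 : ℓ ≤ 1) :
    h '' thickening ℓ T ⊆ thickening ((Λ + L + 1) * ℓ) (h '' T) := by
  rintro _ ⟨z, hz, rfl⟩
  obtain ⟨x, hxT, hzx⟩ := mem_thickening_iff.1 hz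
  exact mem_thickening_iff.2 ⟨h x, mem_image_of_mem h hxT, ai_upper_dist hL hΛ (hD x hxT) hℓr hℓ1 hzx⟩

/-- **Lower sandwich.**  With the `C²` package on the balls `closedBall x r₁`, `x ∈ T`, the
injectivity modulus `R₁ ≤ dist z w → η' ≤ dist (h z) (h w)` on a set `K₂ ⊇ T ∪ V₀` at a
threshold `R₁ ≤ min r₁ (m / (4 (L + 1)))`, and `thickening ε (h '' T) ⊆ h '' V₀`: for
`ℓ' ≤ min ε η'` and `ℓ' ≤ (3m/4) ℓ` we have `thickening ℓ' (h '' T) ⊆ h '' thickening ℓ T`.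
A point `w` within `ℓ'` of `h x`, `x ∈ T`, is `h z` with `z ∈ V₀`; the modulus gives
`dist z x < R₁`, and the lower distance bound `(3m/4) dist z x ≤ dist (h z) (h x) < ℓ'`
gives `dist z x < ℓ`. [folklore] -/
theorem ai_thickening_image_subset {h : ℂ → ℂ} {T V₀ K₂ : Set ℂ}
    {r₁ L m Λ R₁ η' ε ℓ ℓ' : ℝ} (hL : 0 ≤ L) (hm : 0 < m)
    (hD : ∀ x ∈ T, ∀ w ∈ closedBall x r₁, HasDerivAt h (deriv h w) w ∧
      HasDerivAt (deriv h) (deriv (deriv h) w) w ∧ m ≤ ‖deriv h w‖ ∧ ‖deriv h w‖ ≤ Λ ∧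
      ‖deriv (deriv h) w‖ ≤ L)
    (hmod : ∀ z ∈ K₂, ∀ w ∈ K₂, R₁ ≤ dist z w → η' ≤ dist (h z) (h w))
    (hR₁r : R₁ ≤ r₁) (hR₁m : R₁ ≤ m / (4 * (L + 1))) (hTK₂ : T ⊆ K₂) (hV₀K₂ : V₀ ⊆ K₂)
    (hε : thickening ε (h '' T) ⊆ h '' V₀) (hℓ'ε : ℓ' ≤ ε) (hℓ'η : ℓ' ≤ η')
    (hℓ'ℓ : ℓ' ≤ 3 * m / 4 * ℓ) :
    thickening ℓ' (h '' T) ⊆ h '' thickening ℓ T := by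
  intro w hw
  obtain ⟨_, ⟨x, hxT, rfl⟩, hwx⟩ := mem_thickening_iff.1 hw
  obtain ⟨z, hzV₀, rfl⟩ := hε (thickening_mono hℓ'ε _ hw)
  -- the injectivity modulus, contrapositive: `dist z x < R₁`
  have hzx : dist z x < R₁ := by
    by_contra hcon
    exact (not_le.2 (hwx.trans_le hℓ'η)) (hmod z (hV₀K₂ hzV₀) x (hTK₂ hxT) (not_lt.1 hcon))
  -- the lower distance bound on the ball around `x`
  have h34 := ai_lower_dist hL (hD x hxT) hR₁r hR₁m hzx
  have hlt : 3 * m / 4 * dist z x < 3 * m / 4 * ℓ := h34.trans_lt (hwx.trans_le hℓ'ℓ)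
  exact ⟨z, mem_thickening_iff.2 ⟨x, hxT, lt_of_mul_lt_mul_left hlt (by positivity)⟩, rfl⟩

/-- **Measurability of the image** (Lusin–Souslin): for `S ⊆ U` measurable and `h` continuous
and injective on `U`, the image `h '' S` is measurable. [folklore] -/
theorem ai_measurableSet_image {h : ℂ → ℂ} {U S : Set ℂ} (hd : DifferentiableOn ℂ h U)
    (hi : InjOn h U) (hSU : S ⊆ U) (hS : MeasurableSet S) : MeasurableSet (h '' S) :=
  hS.image_of_continuousOn_injOn (hd.continuousOn.mono hSU) (hi.mono hSU)

/-! ### Transport of a sandwiched family along a compact base set -/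

/-- **Transport of sandwiched families.**  Let `h` be holomorphic and injective on the open `U`
and `T ⊆ U` compact.  If the measurable sets `A δ` are eventually (as `δ → 0⁺`) sandwiched
between the `a√δ`- and the `b√δ`-neighbourhoods of `T` (`0 < a ≤ b`), then the sets `h '' A δ`
are measurable and eventually sandwiched between the `a'√δ`- and the `b'√δ`-neighbourhoods of
`h '' T`, with `a' = (m/2) a`, `b' = (Λ + L + 1) b` for the uniform `C²` constants
`0 < m ≤ Λ`, `0 ≤ L` of `h` near `T` (`holo_uniform_bounds`). [folklore] -/
theorem ai_family_image {h : ℂ → ℂ} {U T : Set ℂ} (hU : IsOpen U) (hd : DifferentiableOn ℂ h U)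
    (hi : InjOn h U) (hT : IsCompact T) (hTU : T ⊆ U) {A : ℝ → Set ℂ} {a b : ℝ} (ha : 0 < a)
    (hab : a ≤ b) (hA : ∀ᶠ δ : ℝ in 𝓝[>] 0, MeasurableSet (A δ) ∧
      thickening (a * Real.sqrt δ) T ⊆ A δ ∧ A δ ⊆ thickening (b * Real.sqrt δ) T) :
    ∃ a' b' : ℝ, 0 < a' ∧ a' ≤ b' ∧ ∀ᶠ δ : ℝ in 𝓝[>] 0, MeasurableSet (h '' A δ) ∧
      thickening (a' * Real.sqrt δ) (h '' T) ⊆ h '' A δ ∧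
      h '' A δ ⊆ thickening (b' * Real.sqrt δ) (h '' T) := by
  -- Step 1: the uniform `C²` package on the balls `closedBall x r₁`, `x ∈ T`
  obtain ⟨r₁, L, m, Λ, hr₁, hL, hm, hmΛ, hballU, hD, -, -⟩ :=
    holo_uniform_bounds h U T hU hT hTU hd hi
  have hΛ : 0 < Λ := hm.trans_le hmΛ
  -- Step 2: a compact collar `cthickening r T ⊆ U`; the image of the open collar is open
  obtain ⟨r, hr, hrU⟩ := hT.exists_cthickening_subset_open hU hTU
  have hK₂c : IsCompact (cthickening r T) := hT.cthickening
  have hV₀K₂ : thickening r T ⊆ cthickening r T := thickening_subset_cthickening r T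
  have hV₀U : thickening r T ⊆ U := hV₀K₂.trans hrU
  have hV₀o : IsOpen (h '' thickening r T) :=
    Literature.Topology.Euclidean.Brouwer.isOpen_image_of_injOn rfl isOpen_thickening
      (hd.continuousOn.mono hV₀U) (hi.mono hV₀U)
  -- Step 3: the injectivity modulus on the collar at the threshold `R₁ = min r₁ (m/(4(L+1)))`
  have hR₁pos : 0 < min r₁ (m / (4 * (L + 1))) := lt_min hr₁ (by positivity)
  obtain ⟨η', hη', hmod⟩ := hub_uniform_injOn hK₂c hrU hd.continuousOn hi hR₁pos
  -- Step 4: a uniform radius `ε` with `thickening ε (h '' T) ⊆ h '' thickening r T`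
  obtain ⟨ε, hε, hεV₀⟩ := (hT.image_of_continuousOn (hd.continuousOn.mono hTU))
    |>.exists_thickening_subset_open hV₀o (image_mono (self_subset_thickening hr T))
  -- the constants `a' = (m/2) a ≤ (Λ + L + 1) b = b'`
  have hab' : m / 2 * a ≤ (Λ + L + 1) * b :=
    mul_le_mul (by linarith) hab ha.le (by positivity)
  refine ⟨m / 2 * a, (Λ + L + 1) * b, by positivity, hab', ?_⟩
  filter_upwards [hA, ai_eventually_mul_sqrt_lt (m / 2 * a) hε,
    ai_eventually_mul_sqrt_lt (m / 2 * a) hη', ai_eventually_mul_sqrt_lt b hr₁,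
    ai_eventually_mul_sqrt_lt b one_pos] with δ hAδ h1 h2 h3 h4
  obtain ⟨hmeas, hlow, hup⟩ := hAδ
  refine ⟨ai_measurableSet_image hd hi (hup.trans (ai_thickening_subset hballU h3.le)) hmeas,
    ?_, ?_⟩
  · -- lower sandwich
    have hs : 0 ≤ a * Real.sqrt δ := by positivity
    have hℓ'ℓ : m / 2 * a * Real.sqrt δ ≤ 3 * m / 4 * (a * Real.sqrt δ) :=
      calc m / 2 * a * Real.sqrt δ = m / 2 * (a * Real.sqrt δ) := by ring
        _ ≤ 3 * m / 4 * (a * Real.sqrt δ) := mul_le_mul_of_nonneg_right (by linarith) hs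
    exact (ai_thickening_image_subset hL hm hD hmod (min_le_left _ _) (min_le_right _ _)
      (self_subset_cthickening T) hV₀K₂ hεV₀ h1.le h2.le hℓ'ℓ).trans (image_mono hlow)
  · -- upper sandwich
    have hup' := ai_image_thickening_subset hL hΛ.le hD h3.le h4.le
    have e : (Λ + L + 1) * (b * Real.sqrt δ) = (Λ + L + 1) * b * Real.sqrt δ := by ring
    rw [e] at hup'
    exact (image_mono hup).trans hup'

/-! ### The stub -/

/-- **Transport of admissible families** (brick of the S3b re-cut, `Sig.stub_attachmentImage`):
for `h` holomorphic and injective on an open `U ⊇ closure Ω`, the `h`-images of admissible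
attachment families of `R.arc i` are admissible attachment families of the arc
`(h • R).arc i = h '' R.arc i` of the image rectangle `h • R = R.imageUnivalent h`, and the
`h`-images of admissible carrier families of `R` are admissible carrier families of `h • R`
(`closure (h • R).carrier = h '' closure Ω`).  Both are `ai_family_image` for the compact base
sets `R.arc i`, `closure Ω ⊆ U` (`h` is bi-Lipschitz near `closure Ω`; measurability of the
images by Lusin–Souslin). -/
theorem stub_attachmentImage : Sig.stub_attachmentImage := by
  intro R h U hU hRU hd hi
  have hKc : IsCompact (closure R.carrier) := R.isBounded.isCompact_closure
  refine ⟨fun i A hA => ?_, fun K hK => ?_⟩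
  · obtain ⟨a, b, ha, hab, hA⟩ := hA
    have hTU : R.arc i ⊆ U :=
      ((R.arc_subset_frontier i).trans frontier_subset_closure).trans hRU
    obtain ⟨a', b', ha', hab', h'⟩ :=
      ai_family_image hU hd hi (R.isCompact_arc i) hTU ha hab hA
    refine ⟨a', b', ha', hab', ?_⟩
    have e : (R.imageUnivalent h (hd.mono hRU) (hi.mono hRU)).arc i = h '' R.arc i :=
      MarkedDomain.arc_imageUnivalent R h _ _ i
    filter_upwards [h'] with δ hδ
    rw [e]
    exact hδ
  · obtain ⟨a, b, ha, hab, hK⟩ := hK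
    obtain ⟨a', b', ha', hab', h'⟩ := ai_family_image hU hd hi hKc hRU ha hab hK
    refine ⟨a', b', ha', hab', ?_⟩
    have e : closure (R.imageUnivalent h (hd.mono hRU) (hi.mono hRU)).carrier =
        h '' closure R.carrier :=
      MarkedDomain.closure_carrier_imageUnivalent R h _ _
    filter_upwards [h'] with δ hδ
    rw [e]
    exact hδ

end Summit.CriticalPhenomena.CardyFormulaZ2.Cruxes.VoronoiHubFromSmirnov.MoebiusExactDelaunayDilationWard

end
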